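import Summits.MatrixMultiplication.MatrixMultiplication.Theorems.FidelityWitnessesLinearDefectLawTwoDeficient
import Summits.MatrixMultiplication.MatrixMultiplication.Theorems.FidelityWitnessesLinearDefectLawTraceIneq
import Summits.MatrixMultiplication.MatrixMultiplication.Theorems.FidelityWitnessesLinearDefectLawTwoIff

/-!
# `FidelityWitnesses.LinearDefectLaw` (stmt-MatrixMultiplication-14039) — slot deflation, III: three deficient slots,
# the rank-3 rung `M(2,3) ≤ 4`, and the law at `n = 2` for every `r ∉ {4, 5, 6}`

Support file for item `stmt-MatrixMultiplication-14039` (`LinearDefectLaw`) of route `MatrixMultiplication/FidelityWitnesses`.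
`TwoIff.lawAtTwo_iff` (p93130) showed that the `n = 2` instance of the law is `SevenEighthsLaw ∧ SixEighthsAtFive ∧ (M(2,4) ≤ 5)`,
the rungs `r ≤ 3` being obtained only RELATIVE to the rank-4 rung (downward telescoping `slope_below_window`).  This file proves
the rungs `r ≤ 3` OUTRIGHT:

* THREE DEFICIENT SLOTS (`overlap_sq_le_four_of_annihilated_abc`): if unit functionals `α, β, γ` annihilate the three slots of `S`
  (any rank), then `|⟨S,⟨2,2,2⟩⟩|² ≤ 4‖S‖²`.  Indeed `⟨S,T⟩ = ⟨S, X₃⟩` with `X₃ = (P_{α⊥}⊗P_{β⊥}⊗P_{γ⊥})T` the triple deflation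
  (`…SlotDeflation`), and `‖X₃‖² = 2 + (‖AᵀB‖² + ‖BC‖² + ‖CAᵀ‖² − |tr(AᵀBC)|²)` for the unit `2 × 2` matrices `A = conj α`,
  `B = conj β`, `C = conj γ` (`nsq_triple_le_four`, via the double contractions `sum_norm_cAB_eq` … of `⟨2,2,2⟩`, which are
  `2 × 2` matrix products); the bracket is `≤ 2` by the cyclic trace inequality `TraceIneq.trace_ineq` (`…TraceIneq`).
* Every factor family of a tensor of rank `≤ 3` is deficient (`deficient_of_card_lt`), so `M(2,3) ≤ 4`
  (`overlap_sq_le_four_of_rank_le_three`, registered stub `stub_rankThreeRung`) — the law's rank-3 rung, with the law's constant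
  (`8 + 3 − 7 = 4`; numerically `M(2,3) = 3.0058`).
* With `TwoIff.rung_down` (`slope_below_window`, p90464) the rungs `r = 2, 1, 0` follow, and with Cauchy–Schwarz (`eight_bounds_two`)
  the rungs `r ≥ 7`: `lawAtTwo_off_window` — the `n = 2` instance of `LinearDefectLaw` holds UNCONDITIONALLY at every `r ∉ {4,5,6}`.
  What remains of the item at `n = 2` is exactly the window: `M(2,4) ≤ 5` (open; `≥ 3 + √2`, `Rung24.rung24_ge`; reduced to the
  doubly-concise stratum in `…TwoDeficient`), `M(2,5) ≤ 6` (= `SixEighthsAtFive`, stmt-14040), `M(2,6) ≤ 7` (= `SevenEighthsLaw`,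
  stmt-4959).
-/

noncomputable section

namespace Summit.MatrixMultiplication.MatrixMultiplication.Theorems.LinearDefectLaw.SlotDeflation

open scoped BigOperators ComplexConjugate
open Literature.Computability.AlgebraicComplexity
open Summit.MatrixMultiplication.MatrixMultiplication.Theorems.LinearDefectLaw.Reduction
  (P overlap normSq normSq_nonneg)
open Summit.MatrixMultiplication.MatrixMultiplication.Theorems.LinearDefectLaw.TwoIff (rung_down)

set_option linter.dupNamespace false

/-! ## The double and triple contractions of `⟨2,2,2⟩` as `2 × 2` matrix products -/

/-- `Σ_c |Σ_a conj(α a) cB β T₂ a c|² = ‖AᵀB‖²_F` with `A = conj α`, `B = conj β` (`(AᵀB)_{νμ} = Σ_κ A κν B κμ`). -/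
theorem sum_norm_cAB_eq (α β : P 2 → ℂ) :
    ∑ c, ‖∑ a, conj (α a) * cB β T₂ a c‖ ^ 2 =
      ∑ ν : Fin 2, ∑ μ : Fin 2, ‖∑ κ : Fin 2, conj (α (κ, ν)) * conj (β (κ, μ))‖ ^ 2 := by
  have h : ∀ c : P 2, ∑ a, conj (α a) * cB β T₂ a c = ∑ κ : Fin 2, conj (α (κ, c.2)) * conj (β (κ, c.1)) := by
    intro c
    rw [Fintype.sum_prod_type]
    refine Finset.sum_congr rfl fun κ _ => ?_
    simp only [cB_T₂, mul_ite, mul_zero, Finset.sum_ite_eq', Finset.mem_univ, if_true]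
  simp_rw [h]
  rw [Fintype.sum_prod_type, Finset.sum_comm]

/-- `Σ_b |Σ_a conj(α a) cC γ T₂ a b|² = ‖CAᵀ‖²_F` with `C = conj γ` (`(CAᵀ)_{μκ} = Σ_ν A κν C μν`). -/
theorem sum_norm_cAC_eq (α γ : P 2 → ℂ) :
    ∑ b, ‖∑ a, conj (α a) * cC γ T₂ a b‖ ^ 2 =
      ∑ κ : Fin 2, ∑ μ : Fin 2, ‖∑ ν : Fin 2, conj (α (κ, ν)) * conj (γ (μ, ν))‖ ^ 2 := by
  have h : ∀ b : P 2, ∑ a, conj (α a) * cC γ T₂ a b = ∑ ν : Fin 2, conj (α (b.1, ν)) * conj (γ (b.2, ν)) := by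
    intro b
    rw [Fintype.sum_prod_type, Finset.sum_comm]
    refine Finset.sum_congr rfl fun ν _ => ?_
    simp only [cC_T₂, mul_ite, mul_zero]
    rw [Finset.sum_ite_eq' Finset.univ b.1]
    simp
  simp_rw [h]
  rw [Fintype.sum_prod_type]

/-- `Σ_a |Σ_b conj(β b) cC γ T₂ a b|² = ‖BC‖²_F` (`(BC)_{κν} = Σ_μ B κμ C μν`). -/
theorem sum_norm_cBC_eq (β γ : P 2 → ℂ) :
    ∑ a, ‖∑ b, conj (β b) * cC γ T₂ a b‖ ^ 2 =
      ∑ κ : Fin 2, ∑ ν : Fin 2, ‖∑ μ : Fin 2, conj (β (κ, μ)) * conj (γ (μ, ν))‖ ^ 2 := by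
  have h : ∀ a : P 2, ∑ b, conj (β b) * cC γ T₂ a b = ∑ μ : Fin 2, conj (β (a.1, μ)) * conj (γ (μ, a.2)) := by
    intro a
    rw [Fintype.sum_prod_type, Finset.sum_comm]
    refine Finset.sum_congr rfl fun μ _ => ?_
    simp only [cC_T₂, mul_ite, mul_zero]
    rw [Finset.sum_ite_eq Finset.univ a.1]
    simp
  simp_rw [h]
  rw [Fintype.sum_prod_type]

/-- the triple contraction `Σ conj(α a) conj(β b) cC γ T₂ a b = tr(AᵀBC) = Σ A κν B κμ C μν` -/
theorem sum_cABC_eq (α β γ : P 2 → ℂ) :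
    ∑ a, conj (α a) * ∑ b, conj (β b) * cC γ T₂ a b =
      ∑ κ : Fin 2, ∑ μ : Fin 2, ∑ ν : Fin 2, conj (α (κ, ν)) * conj (β (κ, μ)) * conj (γ (μ, ν)) := by
  have h : ∀ a : P 2, ∑ b, conj (β b) * cC γ T₂ a b = ∑ μ : Fin 2, conj (β (a.1, μ)) * conj (γ (μ, a.2)) := by
    intro a
    rw [Fintype.sum_prod_type, Finset.sum_comm]
    refine Finset.sum_congr rfl fun μ _ => ?_
    simp only [cC_T₂, mul_ite, mul_zero]
    rw [Finset.sum_ite_eq Finset.univ a.1]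
    simp
  simp_rw [h]
  rw [Fintype.sum_prod_type]
  refine Finset.sum_congr rfl fun κ _ => ?_
  rw [Finset.sum_comm]
  refine Finset.sum_congr rfl fun μ _ => ?_
  rw [Finset.mul_sum]
  exact Finset.sum_congr rfl fun ν _ => by ring

/-- a unit functional on `P 2` reshaped as a unit `2 × 2` matrix (conjugated) -/
theorem sum_norm_conj_reshape (α : P 2 → ℂ) (hα : ∑ i, ‖α i‖ ^ 2 = 1) :
    ∑ κ : Fin 2, ∑ ν : Fin 2, ‖conj (α (κ, ν))‖ ^ 2 = 1 := by
  simp_rw [Complex.norm_conj]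
  rw [← hα, Fintype.sum_prod_type]

/-! ## Three deficient slots -/

/-- **The triply deflated tensor has squared norm at most `4`**: `‖(P_{α⊥}⊗P_{β⊥}⊗P_{γ⊥})T₂‖² = 2 + (‖AᵀB‖² + ‖BC‖² + ‖CAᵀ‖² −
|tr(AᵀBC)|²) ≤ 4` by `TraceIneq.trace_ineq`. -/
theorem nsq_triple_le_four (α β γ : P 2 → ℂ) (hα : ∑ i, ‖α i‖ ^ 2 = 1) (hβ : ∑ i, ‖β i‖ ^ 2 = 1)
    (hγ : ∑ i, ‖γ i‖ ^ 2 = 1) : nsq (dC γ (dB β (dA α T₂))) ≤ 4 := by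
  -- the last contraction: `Σ_a |Σ_b conj(β b) cC γ (dA α T₂) a b|² = ‖BC‖² − |tr|²`
  set y : P 2 → ℂ := fun a => ∑ b, conj (β b) * cC γ T₂ a b with hy
  have hlast : ∑ a, ‖∑ b', conj (β b') * cC γ (dA α T₂) a b'‖ ^ 2 =
      (∑ a, ‖y a‖ ^ 2) - ‖∑ a', conj (α a') * y a'‖ ^ 2 := by
    have h1 : ∀ a, ∑ b', conj (β b') * cC γ (dA α T₂) a b' = y a - α a * ∑ a', conj (α a') * y a' := by
      intro a
      simp_rw [cC_dA, mul_sub]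
      rw [Finset.sum_sub_distrib]
      congr 1
      simp_rw [hy, Finset.mul_sum]
      rw [Finset.sum_comm]
      exact Finset.sum_congr rfl fun a' _ => Finset.sum_congr rfl fun b' _ => by ring
    simp_rw [h1]
    exact sum_norm_sq_deflate y α hα
  have htr := TraceIneq.trace_ineq (fun κ ν => conj (α (κ, ν))) (fun κ μ => conj (β (κ, μ)))
    (fun μ ν => conj (γ (μ, ν))) (sum_norm_conj_reshape α hα) (sum_norm_conj_reshape β hβ)
    (sum_norm_conj_reshape γ hγ)
  rw [← sum_norm_cAB_eq, ← sum_norm_cBC_eq, ← sum_norm_cAC_eq, ← sum_cABC_eq] at htr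
  rw [nsq_dC γ hγ, nsq_dB β hβ, nsq_dA α hα, nsq_T₂, sum_norm_cA_T₂, sum_norm_cB_dA α hα, sum_norm_cB_T₂, hα, hβ,
    sum_norm_cC_dB β hβ, sum_norm_cC_dA α hα, sum_norm_cC_T₂, hγ, hlast]
  simp only [hy] at htr ⊢
  linarith

/-- **Three deficient slots.** If unit functionals annihilate the three slots of `S` (`Σ_a α a S a b c = 0`, `Σ_b β b S a b c = 0`,
`Σ_c γ c S a b c = 0`), then `|⟨S,⟨2,2,2⟩⟩|² ≤ 4‖S‖²`, for `S` of ANY rank (the rank-3 rung's constant). -/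
theorem overlap_sq_le_four_of_annihilated_abc (S : P 2 → P 2 → P 2 → ℂ) (α β γ : P 2 → ℂ)
    (hα : ∑ i, ‖α i‖ ^ 2 = 1) (hβ : ∑ i, ‖β i‖ ^ 2 = 1) (hγ : ∑ i, ‖γ i‖ ^ 2 = 1)
    (hSa : ∀ b c, ∑ a, α a * S a b c = 0) (hSb : ∀ a c, ∑ b, β b * S a b c = 0)
    (hSc : ∀ a b, ∑ c, γ c * S a b c = 0) :
    ‖overlap S‖ ^ 2 ≤ 4 * normSq S := by
  have hp : overlap S = pair S (dC γ (dB β (dA α T₂))) := by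
    rw [pair_dC γ hSc, pair_dB β hSb, pair_dA α hSa, pair_T₂]
  rw [hp]
  calc ‖pair S (dC γ (dB β (dA α T₂)))‖ ^ 2 ≤ nsq S * nsq (dC γ (dB β (dA α T₂))) := norm_pair_sq_le _ _
    _ ≤ nsq S * 4 := mul_le_mul_of_nonneg_left (nsq_triple_le_four α β γ hα hβ hγ) (nsq_nonneg S)
    _ = 4 * normSq S := by rw [nsq_eq_normSq, mul_comm]

/-- **Sums of triads with three deficient factor families** (any number of triads): `|⟨S,⟨2,2,2⟩⟩|² ≤ 4‖S‖²`. -/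
theorem overlap_sq_le_four_of_three_deficient {r : ℕ} (x y z : Fin r → P 2 → ℂ)
    (hx : ∃ α : P 2 → ℂ, (∑ i, ‖α i‖ ^ 2 = 1) ∧ ∀ l, ∑ a, α a * x l a = 0)
    (hy : ∃ β : P 2 → ℂ, (∑ i, ‖β i‖ ^ 2 = 1) ∧ ∀ l, ∑ b, β b * y l b = 0)
    (hz : ∃ γ : P 2 → ℂ, (∑ i, ‖γ i‖ ^ 2 = 1) ∧ ∀ l, ∑ c, γ c * z l c = 0) :
    ‖overlap (∑ l, triad (x l) (y l) (z l))‖ ^ 2 ≤ 4 * normSq (∑ l, triad (x l) (y l) (z l)) := by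
  obtain ⟨α, hα, hx⟩ := hx
  obtain ⟨β, hβ, hy⟩ := hy
  obtain ⟨γ, hγ, hz⟩ := hz
  exact overlap_sq_le_four_of_annihilated_abc _ α β γ hα hβ hγ (annihilated_a_of_triads x y z α hx)
    (annihilated_b_of_triads x y z β hy) (annihilated_c_of_triads x y z γ hz)

/-! ## The rank-3 rung and the law off the window -/

/-- **`M(2,3) ≤ 4`** — the law's rank-3 rung at `n = 2`, unconditionally: `|⟨S,⟨2,2,2⟩⟩|² ≤ 4‖S‖²` for every `S` of rank
`≤ 3` (three triads: every factor family has fewer than `4` members, hence is deficient). -/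
theorem overlap_sq_le_four_of_rank_le_three (S : P 2 → P 2 → P 2 → ℂ) (hS : tensorRank S ≤ 3) :
    ‖overlap S‖ ^ 2 ≤ 4 * normSq S := by
  obtain ⟨x, y, z, rfl⟩ := exists_eq_sum_triad_of_tensorRank_le hS
  exact overlap_sq_le_four_of_three_deficient x y z (deficient_of_card_lt (by simp) x)
    (deficient_of_card_lt (by simp) y) (deficient_of_card_lt (by simp) z)

/-- **The rungs `r ≤ 3`**: `M(2,r) ≤ r + 1` for `r ≤ 3` (from the rank-3 rung by `TwoIff.rung_down`, i.e. `slope_below_window`). -/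
theorem overlap_sq_le_of_rank_le {r : ℕ} (hr : r ≤ 3) (S : P 2 → P 2 → P 2 → ℂ) (hS : tensorRank S ≤ r) :
    ‖overlap S‖ ^ 2 ≤ ((r : ℝ) + 1) * normSq S := by
  have r3 : ∀ S : P 2 → P 2 → P 2 → ℂ, tensorRank S ≤ 3 → ‖overlap S‖ ^ 2 ≤ 4 * normSq S :=
    overlap_sq_le_four_of_rank_le_three
  have r2 : ∀ S : P 2 → P 2 → P 2 → ℂ, tensorRank S ≤ 2 → ‖overlap S‖ ^ 2 ≤ 3 * normSq S := by
    intro S hS; have key := rung_down (r := 2) (by norm_num) r3 S hS; norm_num at key; exact key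
  have r1 : ∀ S : P 2 → P 2 → P 2 → ℂ, tensorRank S ≤ 1 → ‖overlap S‖ ^ 2 ≤ 2 * normSq S := by
    intro S hS; have key := rung_down (r := 1) (by norm_num) r2 S hS; norm_num at key; exact key
  have r0 : ∀ S : P 2 → P 2 → P 2 → ℂ, tensorRank S ≤ 0 → ‖overlap S‖ ^ 2 ≤ 1 * normSq S := by
    intro S hS; have key := rung_down (r := 0) (by norm_num) r1 S hS; norm_num at key ⊢; exact key
  interval_cases r
  · simpa using r0 S hS
  · have := r1 S hS; norm_num; exact this
  · have := r2 S hS; norm_num; exact this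
  · have := r3 S hS; norm_num; exact this

/-- **`LinearDefectLaw` at `n = 2` off the window, unconditionally.** For every `r ∉ {4, 5, 6}` the `n = 2` instance of the law
holds: `|⟨S,⟨2,2,2⟩⟩|² ≤ (2³ + r − R̲(⟨2,2,2⟩))·‖S‖²` for every `S` of rank `≤ r` (tree: `R̲(⟨2,2,2⟩) = 7`).  The window rungs
`r = 4, 5, 6` are `M(2,4) ≤ 5`, `SixEighthsAtFive`, `SevenEighthsLaw` (`TwoIff.lawAtTwo_iff`). -/
theorem lawAtTwo_off_window (r : ℕ) (hr : r ≤ 3 ∨ 7 ≤ r)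
    (S : Fin 2 × Fin 2 → Fin 2 × Fin 2 → Fin 2 × Fin 2 → ℂ) (hS : tensorRank S ≤ r) :
    ‖∑ a, ∑ b, ∑ c, S a b c * matMulTensor ℂ 2 2 2 a b c‖ ^ 2 ≤
      (((2 : ℕ) : ℝ) ^ 3 + (r : ℝ) - (algBorderRank (matMulTensor ℂ 2 2 2) : ℝ)) *
        ∑ a, ∑ b, ∑ c, ‖S a b c‖ ^ 2 := by
  have e : (((2 : ℕ) : ℝ) ^ 3 + (r : ℝ) - ((7 : ℕ) : ℝ)) = (r : ℝ) + 1 := by push_cast; ring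
  rw [algBorderRank_matMulTensor_two ℂ, e]
  show ‖overlap S‖ ^ 2 ≤ ((r : ℝ) + 1) * normSq S
  rcases hr with hr | hr
  · exact overlap_sq_le_of_rank_le hr S hS
  · have h8 := Reduction.eight_bounds_two r S hS
    have hr' : (8 : ℝ) ≤ (r : ℝ) + 1 := by
      have : (7 : ℝ) ≤ (r : ℝ) := by exact_mod_cast hr
      linarith
    exact h8.trans (mul_le_mul_of_nonneg_right hr' (normSq_nonneg S))

/-- **What is left of the item at `n = 2`.**  The `n = 2` instance of `LinearDefectLaw` is equivalent to
`SevenEighthsLaw ∧ SixEighthsAtFive ∧ (M(2,4) ≤ 5 on the doubly-concise stratum)`: `TwoIff.lawAtTwo_iff` combined with the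
reduction `rung24_of_doublyConcise` of `…TwoDeficient`. -/
theorem lawAtTwo_iff_doublyConcise :
    (∀ r : ℕ, ∀ S : Fin 2 × Fin 2 → Fin 2 × Fin 2 → Fin 2 × Fin 2 → ℂ, tensorRank S ≤ r →
      ‖∑ a, ∑ b, ∑ c, S a b c * matMulTensor ℂ 2 2 2 a b c‖ ^ 2 ≤
        (((2 : ℕ) : ℝ) ^ 3 + (r : ℝ) - (algBorderRank (matMulTensor ℂ 2 2 2) : ℝ)) *
          ∑ a, ∑ b, ∑ c, ‖S a b c‖ ^ 2) ↔
    Summit.MatrixMultiplication.MatrixMultiplication.Theses.FidelityWitnesses.SevenEighthsLaw ∧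
    Summit.MatrixMultiplication.MatrixMultiplication.Theses.FidelityWitnesses.SixEighthsAtFive ∧
      ∀ x y z : Fin 4 → P 2 → ℂ,
        ((LinearIndependent ℂ x ∧ LinearIndependent ℂ y) ∨ (LinearIndependent ℂ x ∧ LinearIndependent ℂ z) ∨
          (LinearIndependent ℂ y ∧ LinearIndependent ℂ z)) →
        ‖overlap (∑ l, triad (x l) (y l) (z l))‖ ^ 2 ≤ 5 * normSq (∑ l, triad (x l) (y l) (z l)) := by
  rw [TwoIff.lawAtTwo_iff]
  constructor
  · rintro ⟨h6, h5, h4⟩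
    refine ⟨h6, h5, fun x y z _ => h4 _ ?_⟩
    exact tensorRank_le_of_eq_sum x y z rfl
  · rintro ⟨h6, h5, h⟩
    exact ⟨h6, h5, rung24_of_doublyConcise h⟩

/-- **Registered stub `stub_rankThreeRung`** (raw form of `overlap_sq_le_four_of_rank_le_three`): the rank-3 rung `M(2,3) ≤ 4`. -/
theorem stub_rankThreeRung : ∀ S : Fin 2 × Fin 2 → Fin 2 × Fin 2 → Fin 2 × Fin 2 → ℂ, tensorRank S ≤ 3 → ‖∑ a, ∑ b, ∑ c, S a b c * matMulTensor ℂ 2 2 2 a b c‖ ^ 2 ≤ 4 * ∑ a, ∑ b, ∑ c, ‖S a b c‖ ^ 2 :=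
  fun S hS => overlap_sq_le_four_of_rank_le_three S hS

end Summit.MatrixMultiplication.MatrixMultiplication.Theorems.LinearDefectLaw.SlotDeflation

end
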